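import Literature.IUT.LogThetaLattice.RealifiedSemisimplificationProofsC
import HarnessLib

/-!
# [IUTchIII] Remark 3.9.4 (iii) «`μ_k(S) = μ_k(log_k(S))`»: the FACT row F-0431 DECIDED as typed

Proof-only companion (abc-iut cell, L6 home, L-F register row LF6-46 of `plan/L6/LF-IUT.tsv` v2.1;
FACT-LIST row F-0431 `Remark394iii_logPreservesVolume`, paper tag [AbsTopIII] Prop. 5.7 (i)(c) via
[IUTchIII] Rmk 3.9.4 (iii); DAG node IUTchIII:Rmk3.9.4(iii)) of abc-iut-L6-t4's
`Literature/IUT/LogThetaLattice/RealifiedSemisimplification.lean` (S. Mochizuki, *Inter-universal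
Teichmüller theory III*, kurims manuscript (May 2020), §3, Remark 3.9.4 (iii), p. 122: "for any compact
ample subset `S ⊆ 𝒪^×_k` on which `log_k : 𝒪^×_k → k` is injective, we have `μ_k(S) = μ_k(log_k(S))`
[cf. [AbsTopIII], Proposition 5.7, (i), (c)]"; claim key Mochizuki2012, DISPUTED, D-0012 — the content
decided here is undisputed `p`-adic measure theory).  NO definitions, NO instances, NO new `Prop` facts.

The typed clause `Remark394iii_logPreservesVolume U logk vol` is a SCHEMA over abstract data
(`U ⊆ k`, `logk : k → k`, `vol : Set k → ℝ≥0∞`).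

* **Instance forms are the content and HOLD** — already in tree, by abc-iut-L6-d5 / L6-d4:
  `remark394iii_logPreservesVolume_unitLog` (any additive Haar measure), `…_localHaar` (the printed
  normalisation `μ_k(𝒪_k) = 1`), `…_of_isAddLeftInvariant` (any translation-invariant Borel measure finite
  on compacts), at `U := 𝒪_K^×`, `logk := log_p` (`Literature.IUT.LogVolume.unitLog`), for every
  mixed-characteristic nonarchimedean local field `K ⊇ ℚ_p`; non-vacuity of the quantifier by abc-iut-L6-t6's
  `exists_isAmple_isCompact_injOn_unitLog`.  Here: the CONCRETE instance `k := ℚ_p` with zero residual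
  binders (`remark394iii_logPreservesVolume_padic`).
* **The universal closure is NOT a fact** (`not_remark394iii_logPreservesVolume_dirac`,
  `not_forall_Remark394iii_logPreservesVolume`): keep the GENUINE carrier `k = K`, `U = 𝒪_K^×`,
  `logk = log_p`, but take for `vol` the Dirac mass at `1` (a probability measure that is not translation
  invariant): the compact ball `S := {‖y - 1‖ ≤ ‖p*‖} ⊆ 𝒪_K^×` has `vol S = 1 > 0`, `log_p` is injective on
  it (abc-iut-L6-d4 `injOn_unitLog_closedBall`) and isometric there (`dist_unitLog_eq_dist`), so every
  `log_p y`, `y ∈ S`, has `‖log_p y‖ = ‖y - 1‖ < 1 = ‖1‖`; hence `1 ∉ log_p(S)` and `vol(log_p S) = 0 ≠ 1`.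
  The Haar / translation-invariance binder of the instance forms is therefore LOAD-BEARING, and the
  bare schema (FACT-LIST rule R5) is refuted as typed.

Honest framing: statements about OUR typing; nothing here bears on [IUTchIII] Cor. 3.12 or asserts abc
proved or refuted; no side taken; typed ≠ proved for the disputed corpus.
-/

set_option autoImplicit false

noncomputable section

open MeasureTheory MeasureTheory.Measure Set Metric
open scoped NNReal ENNReal

namespace Literature.IUT.LogThetaLattice

open Literature.IUT.LogVolume Literature.AnabelianGeometry.AbsoluteAnabelian

/-! ### 1. The concrete instance `k := ℚ_p` -/

/-- **IUTchIII:Rmk3.9.4(iii)** (kurims p.122) AT `k := ℚ_p` ITSELF, zero residual binders: for every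
additive Haar measure `μ` of `ℚ_p` (w.r.t. its Borel σ-algebra) and every compact `S ⊆ ℤ_p^×` of positive
measure on which `log_p` is injective, `μ(log_p S) = μ(S)` — abc-iut-L6-d5's
`remark394iii_logPreservesVolume_unitLog` at `K := ℚ_[p]`.  FACT row F-0431, instance form.
[claim: Mochizuki2012, status: disputed] -/
theorem remark394iii_logPreservesVolume_padic (p : ℕ) [Fact p.Prime] [MeasurableSpace ℚ_[p]]
    [BorelSpace ℚ_[p]] (μ : Measure ℚ_[p]) [IsAddHaarMeasure μ] :
    Remark394iii_logPreservesVolume {x : ℚ_[p] | ‖x‖ = 1} (unitLog : ℚ_[p] → ℚ_[p]) μ :=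
  remark394iii_logPreservesVolume_unitLog p ℚ_[p] μ

/-! ### 2. The universal closure is refutable: a non-invariant «volume» on the genuine carrier -/

section Dirac

variable (p : ℕ) [hp : Fact p.Prime]
variable (K : Type*) [NontriviallyNormedField K] [instK : NormedAlgebra ℚ_[p] K]
  [IsUltrametricDist K] [ProperSpace K] [MeasurableSpace K] [MeasurableSingletonClass K]
include instK

/-- **IUTchIII:Rmk3.9.4(iii)** (kurims p.122) — the typed schema FAILS on the genuine carrier
(`K ⊇ ℚ_p` a mixed-characteristic nonarchimedean local field, `U := 𝒪_K^× = sphere 0 1`,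
`logk := log_p`) as soon as `vol` is the DIRAC MASS at `1` instead of a Haar measure: the compact ball
`S := closedBall 1 ‖p*‖ ⊆ 𝒪_K^×` has Dirac mass `1`, `log_p` is injective on it, and
`log_p(S) ⊆ {‖z‖ < 1} ∌ 1` has Dirac mass `0`.  (FACT row F-0431 refuted AS A SCHEMA; the Haar binder of
the instance forms is load-bearing.) [claim: Mochizuki2012, status: disputed] -/
theorem not_remark394iii_logPreservesVolume_dirac :
    ¬ Remark394iii_logPreservesVolume (sphere (0 : K) 1) (unitLog : K → K)
        (fun A => Measure.dirac (1 : K) A) := by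
  intro h
  -- the radius `r := ‖p*‖` of abc-iut-L3-t11 / L6-d4
  set r : ℝ := ‖((p ^ (if p = 2 then 2 else 1) : ℕ) : K)‖ with hrdef
  have hr : 0 < r := norm_pos_iff.mpr (pstarPow_cast_ne_zero p K)
  have hr1 : r < 1 := by
    have hθ := mul_rpow_lt_one_of_le_norm_pstarPow p (le_refl r)
    have hp1 : (1 : ℝ) ≤ p := by exact_mod_cast (Fact.out : p.Prime).one_lt.le
    have hq : 1 ≤ (p : ℝ) ^ (1 / ((p : ℝ) - 1)) :=
      Real.one_le_rpow hp1 (div_nonneg zero_le_one (by linarith))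
    calc r = r * 1 := (mul_one r).symm
      _ ≤ r * (p : ℝ) ^ (1 / ((p : ℝ) - 1)) := by gcongr
      _ < 1 := hθ
  have h1 : ‖(1 : K)‖ = 1 := norm_one
  -- the witness set
  have hSU : closedBall (1 : K) r ⊆ sphere (0 : K) 1 := fun y hy =>
    mem_sphere_zero_iff_norm.mpr (norm_eq_one_of_mem_closedBall_unit h1 hr1 hy)
  have hSc : IsCompact (closedBall (1 : K) r) := isCompact_closedBall _ _
  have hpos : 0 < Measure.dirac (1 : K) (closedBall (1 : K) r) := by
    rw [Measure.dirac_apply_of_mem (mem_closedBall_self hr.le)]; exact one_pos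
  have hinj : InjOn (unitLog : K → K) (closedBall (1 : K) r) := injOn_unitLog_closedBall p h1 le_rfl
  have key : Measure.dirac (1 : K) (unitLog '' closedBall (1 : K) r) =
      Measure.dirac (1 : K) (closedBall (1 : K) r) := h _ hSU hSc hpos hinj
  rw [Measure.dirac_apply_of_mem (mem_closedBall_self hr.le)] at key
  -- `1 ∉ log_p(S)`: every value has norm `< 1`
  have hnot : (1 : K) ∉ unitLog '' closedBall (1 : K) r := by
    rintro ⟨y, hy, hy1⟩
    have hd := dist_unitLog_eq_dist p h1 (le_refl r) hy (mem_closedBall_self hr.le)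
    rw [unitLog_one p, hy1, dist_eq_norm, sub_zero, h1, dist_eq_norm] at hd
    have : ‖y - 1‖ ≤ r := mem_closedBall_iff_norm.mp hy
    linarith
  have hzero : Measure.dirac (1 : K) (unitLog '' closedBall (1 : K) r) = 0 := by
    refine le_antisymm ?_ bot_le
    calc Measure.dirac (1 : K) (unitLog '' closedBall (1 : K) r)
        ≤ Measure.dirac (1 : K) ({1}ᶜ) := measure_mono fun z hz => by
          rintro rfl; exact hnot hz
      _ = 0 := by
          rw [Measure.dirac_apply' _ (MeasurableSet.singleton (1 : K)).compl]
          simp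
  rw [hzero] at key
  exact zero_ne_one key

end Dirac

/-- **IUTchIII:Rmk3.9.4(iii)** (kurims p.122) — the UNIVERSAL CLOSURE of the typed schema
`Remark394iii_logPreservesVolume` (over all topological carriers `k`, unit sets `U`, maps `logk` and
«volumes» `vol`) is FALSE: witness `k := ℚ₂`, `U := ℤ₂^×`, `logk := log_2`, `vol :=` Dirac mass at `1`
(`not_remark394iii_logPreservesVolume_dirac`).  FACT row F-0431: DECIDED — schema refuted as typed,
instance forms at Haar / translation-invariant measures PROVED (`remark394iii_logPreservesVolume_unitLog`,
`…_localHaar`, `…_of_isAddLeftInvariant`, `…_padic`). [claim: Mochizuki2012, status: disputed] -/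
theorem not_forall_Remark394iii_logPreservesVolume :
    ¬ ∀ (k : Type) [TopologicalSpace k] (U : Set k) (logk : k → k) (vol : Set k → ℝ≥0∞),
        Remark394iii_logPreservesVolume U logk vol := by
  intro h
  haveI : Fact (Nat.Prime 2) := ⟨Nat.prime_two⟩
  letI : MeasurableSpace ℚ_[2] := borel _
  haveI : BorelSpace ℚ_[2] := ⟨rfl⟩
  exact not_remark394iii_logPreservesVolume_dirac 2 ℚ_[2]
    (h ℚ_[2] (sphere (0 : ℚ_[2]) 1) unitLog fun A => Measure.dirac (1 : ℚ_[2]) A)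

end Literature.IUT.LogThetaLattice

end
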